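import Summits.CriticalPhenomena.SAWScalingLimit.Theorems.SAWTotalPositivityTPToTraversalBoundChainIter
import Summits.CriticalPhenomena.SAWScalingLimit.Theorems.SAWTotalPositivityTPToTraversalBoundChainTransfer

/-!
# Radial chain for `TPToTraversalBound`, part III: `stub_chain`

Crux `SAWTotalPositivity.TPToTraversalBound` (stmt-CriticalPhenomena-10687), line `radial-portal-transfer`,
stub `stub_chain` (bookkeeping: heaviness contraction + top state ⇒ (H1) on interior shells).

Assembly of the registered stub `stub_chain : HeavinessContraction → TopHeaviness → InteriorShellBound`
from the abstract iteration (`stub_chain_iter`, part I), the factoring of the heaviness through the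
outside configuration and the conversion of traversals into heaviness (`stub_chain_transfer`,
part II), on the finite SAW space of the bounded Dobrushin domain (`finite_domainSAW`,
`toReal_law_setOf`).
-/

noncomputable section

open MeasureTheory Filter Topology Set Metric
open scoped NNReal ENNReal unitInterval
open Literature.Probability.LatticeModels
open Literature.Probability.RandomPlanarGeometry
open Literature.Probability.RandomPlanarGeometry.SAW
open Summit.CriticalPhenomena.SAWScalingLimit.Theses.SAWTotalPositivity

namespace Summit.CriticalPhenomena.SAWScalingLimit.Theorems.TPToTraversalBound.Radial

variable {Ω : Set ℂ} {δ : ℝ} {u v : Site 2}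

/-! ## Finiteness of the SAW space and the law as a weighted finite set -/

/-- For a bounded domain and a positive mesh there are finitely many SAWs of `Ω_δ` between two
given sites (paths of the locally finite graph `Ω_δ` of length `≤ |Ω_δ|`). [folklore] -/
-- adapted from Summits/CriticalPhenomena/SAWScalingLimit/Cruxes/ShellCrossingBound/Disproof.lean
theorem finite_domainSAW (hΩ : Bornology.IsBounded Ω) (hδ : 0 < δ) (u v : Site 2) :
    Finite (DomainSAW Ω δ u v) := by
  classical
  have hfin : (meshDomain Ω δ).Finite := meshDomain_finite hΩ hδ
  haveI hLF : (discreteDomainGraph Ω δ).LocallyFinite := fun w =>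
    (hfin.subset fun w' hw' =>
      (discreteDomainGraph_adj_iff.1 ((SimpleGraph.mem_neighborSet _ _ _).1 hw')).2.2).fintype
  have hsupp : ∀ {u v : Site 2} (p : (discreteDomainGraph Ω δ).Walk u v),
      ∀ w ∈ p.support.tail, w ∈ meshDomain Ω δ := by
    intro u v p
    induction p with
    | nil => intro w hw; simp at hw
    | cons h q ih =>
      intro w hw
      rw [SimpleGraph.Walk.support_cons, List.tail_cons, SimpleGraph.Walk.mem_support_iff] at hw
      rcases hw with rfl | hw
      · exact (discreteDomainGraph_adj_iff.1 h).2.2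
      · exact ih w hw
  have hlen : ∀ (p : (discreteDomainGraph Ω δ).Walk u v),
      p.IsPath → p.length < hfin.toFinset.card + 1 := by
    intro p hp
    have hnd : p.support.tail.Nodup := List.Nodup.sublist (List.tail_sublist _) hp.support_nodup
    have h1 : p.support.tail.length = p.length := by
      rw [List.length_tail, SimpleGraph.Walk.length_support]
      rfl
    have h2 : p.support.tail.toFinset ⊆ hfin.toFinset := by
      intro w hw
      rw [Set.Finite.mem_toFinset]
      exact hsupp p w (List.mem_toFinset.1 hw)
    have h3 := Finset.card_le_card h2
    rw [List.toFinset_card_of_nodup hnd, h1] at h3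
    omega
  refine Finite.of_injective
    (β := {p : (discreteDomainGraph Ω δ).Walk u v // p.IsPath ∧ p.length < hfin.toFinset.card + 1})
    (fun γ => ⟨γ.walk, γ.isPath, hlen γ.walk γ.isPath⟩) ?_
  rintro ⟨p, hp⟩ ⟨q, hq⟩ h
  have hpq : p = q := congrArg Subtype.val h
  cases hpq
  rfl

/-- The SAW law is finite on every event: its mass is at most `1` whatever the junk conventions
(cf. `law_apply_le_one` of the crux's `Negative/TPToTraversalBoundLogic.lean`). [folklore] -/
theorem law_ne_top (S : Set (DomainSAW Ω δ u v)) : law Ω δ u v S ≠ ⊤ := by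
  refine ne_top_of_le_ne_top ENNReal.one_ne_top ?_
  calc law Ω δ u v S ≤ law Ω δ u v Set.univ := measure_mono (Set.subset_univ _)
    _ = (weight Ω δ u v Set.univ)⁻¹ * weight Ω δ u v Set.univ := by
        rw [law, Measure.smul_apply, smul_eq_mul]
    _ ≤ 1 := ENNReal.inv_mul_le_one _

/-- On the finite SAW space the law of an event is the sum of its atoms. [folklore] -/
theorem toReal_law_setOf [Fintype (DomainSAW Ω δ u v)] (p : DomainSAW Ω δ u v → Prop)
    [DecidablePred p] :
    (law Ω δ u v {γ | p γ}).toReal = ∑ γ with p γ, (law Ω δ u v {γ}).toReal := by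
  rw [← ENNReal.toReal_sum (fun γ _ => law_ne_top _)]
  congr 1
  rw [MeasureTheory.sum_measure_singleton]
  congr 1
  ext γ
  simp

/-! ## Clean boxes inside balls -/

/-- The clean square of half-side `Nδ` lies in the disc of radius `2Nδ` about its centre.
[folklore] -/
theorem closedBox_subset_closedBall (δ : ℝ) (c : Site 2) (N : ℕ) :
    closedBox δ c N ⊆ Metric.closedBall (meshPoint δ c) (2 * N * δ) := by
  intro z hz
  obtain ⟨h1, h2⟩ := hz
  rw [Metric.mem_closedBall, Complex.dist_eq]
  refine (Complex.norm_le_abs_re_add_abs_im _).trans ?_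
  simp only [Complex.sub_re, Complex.sub_im]
  linarith
/-! ## Assembly -/

/-! ## Scale arithmetic -/

/-- The master inequality of the scales: with `N_L ≤ 6ρ/δ` and `4^{L+3} ρ ≤ R`, the top box
`N_0 = 4^L N_L` satisfies `(4 N_0 + 1) δ ≤ R`. [folklore] -/
theorem scales_master_ineq {δ ρ R : ℝ} {L : ℕ} {NL : ℝ} (hδ0 : 0 < δ) (hρ0 : 0 < ρ)
    (hδρ : δ ≤ ρ) (hNLle : NL ≤ 6 * (ρ / δ)) (hmain : 4 ^ (L + 3) * ρ ≤ R) :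
    (4 * ((4 : ℝ) ^ L * NL) + 1) * δ ≤ R := by
  have h2 : NL * δ ≤ 6 * ρ := by
    have := mul_le_mul_of_nonneg_right hNLle hδ0.le
    rwa [mul_assoc, div_mul_cancel₀ _ hδ0.ne'] at this
  have h4 : (4 : ℝ) ^ (L + 3) = 4 ^ L * 64 := by rw [pow_add]; norm_num
  have h5 : (0 : ℝ) < 4 ^ L := pow_pos (by norm_num) L
  have h6 : ρ ≤ 4 ^ L * ρ := le_mul_of_one_le_left hρ0.le (one_le_pow₀ (by norm_num))
  calc (4 * (4 ^ L * NL) + 1) * δ = 4 * 4 ^ L * (NL * δ) + δ := by ring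
    _ ≤ 4 * 4 ^ L * (6 * ρ) + ρ := by gcongr
    _ ≤ 4 ^ L * 64 * ρ := by nlinarith
    _ ≤ R := by rw [← h4]; exact hmain

/-- The gain of `L` contraction steps at ratio `4^{-λ}` against the shell ratio: if
`R < 4^{L+4} ρ` then `(4^{-λ})^L ≤ 256^λ (ρ/R)^λ`. [folklore] -/
theorem eps_pow_le_shell {lam ρ R : ℝ} {L : ℕ} (hlam : 0 < lam) (hρ0 : 0 < ρ) (hR0 : 0 < R)
    (hLspec : R < 4 ^ (L + 4) * ρ) :
    ((4 : ℝ) ^ (-lam)) ^ L ≤ (256 : ℝ) ^ lam * (ρ / R) ^ lam := by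
  have h4 : (0 : ℝ) ≤ 4 := by norm_num
  have h4L : (0 : ℝ) < (4 : ℝ) ^ (L : ℝ) := Real.rpow_pos_of_pos (by norm_num) _
  have hq0 : 0 < ρ / R := div_pos hρ0 hR0
  have h1 : ((4 : ℝ) ^ (-lam)) ^ L = (((4 : ℝ) ^ (L : ℝ))⁻¹) ^ lam := by
    rw [← Real.rpow_natCast, ← Real.rpow_mul h4, Real.inv_rpow h4L.le,
      ← Real.rpow_neg h4L.le, ← Real.rpow_mul h4]
    ring_nf
  have key : (1 : ℝ) ≤ 4 ^ L * (256 * (ρ / R)) := by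
    rw [show (4 : ℝ) ^ L * (256 * (ρ / R)) = 4 ^ (L + 4) * ρ / R by rw [pow_add]; ring,
      le_div_iff₀ hR0, one_mul]
    exact hLspec.le
  rw [h1, ← Real.mul_rpow (by norm_num) hq0.le]
  refine Real.rpow_le_rpow (inv_nonneg.2 h4L.le) ?_ hlam.le
  rw [inv_le_iff_one_le_mul₀ h4L, Real.rpow_natCast]
  linarith [key]

/-- The trivial regime `R < 256 ρ`: the claimed bound is at least `1`. [folklore] -/
theorem one_le_trivial_regime {lam ρ R CY : ℝ} (hlam : 0 < lam) (hρ0 : 0 < ρ) (hR0 : 0 < R)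
    (hCY : 0 ≤ CY) (h : R < 256 * ρ) :
    (1 : ℝ) ≤ (CY * (256 : ℝ) ^ lam + (256 : ℝ) ^ lam) * (ρ / R) ^ lam := by
  have hq0 : 0 < ρ / R := div_pos hρ0 hR0
  have h256 : 0 < (256 : ℝ) ^ lam := Real.rpow_pos_of_pos (by norm_num) _
  have hqlam : 0 ≤ (ρ / R) ^ lam := Real.rpow_nonneg hq0.le lam
  have hq' : (1 : ℝ) / 256 < ρ / R := by
    rw [lt_div_iff₀ hR0]; linarith
  have h1 : (1 : ℝ) ≤ (256 : ℝ) ^ lam * (ρ / R) ^ lam := by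
    rw [← Real.mul_rpow (by norm_num) hq0.le]
    exact Real.one_le_rpow (by linarith) hlam.le
  nlinarith [mul_nonneg hCY h256.le]

/-- **STUB `stub_chain` (bookkeeping of the line `radial-portal-transfer`).** Heaviness
contraction over ratio-`4` clean boxes plus the exponential tail of the top state give the
Aizenman–Burchard hypothesis (H1) on interior shells with every exponent `λ`: pin the walk at
the nested clean lattice boxes `B_∞(c, 4^{L-l} N_L)`, `c` the nearest site of `x`,
`N_L = ⌈ρ/δ⌉ + 4`, `4^{L+3} ρ ≤ R < 4^{L+4} ρ`; the outside configurations generate a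
filtration (`outEdgeSet_eq_of_le`), the heaviness is measurable (`findGreatest_eq_of_outEdgeSet_eq`),
so the abstract supermartingale iteration `stub_chain_iter` bounds
`P(∀ l ≤ L, h_l ≥ k) ≤ C_Y ζ(k)^L` with `ζ(k) ≤ 4^{-λ}` for the chosen threshold `k`; and
`2k` separate traversals of `D(x; ρ, R)` force `h_l ≥ k` at every scale
(`stub_chain_transfer`). Shells with `R < 256 ρ` are free (`law ≤ 1`).
[cite: KemppainenSmirnov2017, §3 (proof of Thm 3.4)] -/
theorem stub_chain : HeavinessContraction → TopHeaviness → InteriorShellBound := by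
  intro hHC hTop lam hlam D a b hab
  classical
  -- constants of the two hypotheses
  obtain ⟨θ, lam0, C, m₀, hθ1, hlam0, hHC⟩ := hHC
  obtain ⟨CT, c₁, δT, hc₁, hδT, hTop⟩ := hTop D a b hab
  set θ' : ℝ := max θ 0 with hθ'
  set C' : ℝ := max C 0 with hC'
  set CT' : ℝ := max CT 0 with hCT'
  have hθ'0 : 0 ≤ θ' := le_max_right _ _
  have hθ'1 : θ' < 1 := max_lt hθ1 one_pos
  have hC'0 : 0 ≤ C' := le_max_right _ _
  have hCT'0 : 0 ≤ CT' := le_max_right _ _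
  -- the threshold and the potential constant of the chain at ratio `ε = 4^{-λ}`
  set ε : ℝ := (4 : ℝ) ^ (-lam) with hε
  have hε0 : 0 < ε := Real.rpow_pos_of_pos (by norm_num) _
  obtain ⟨kk, CY, hCY0, hchain⟩ :=
    stub_chain_iter (m₀ := m₀) hθ'0 hθ'1 hlam0 hc₁ hC'0 hCT'0 hε0
  have h256 : 0 < (256 : ℝ) ^ lam := Real.rpow_pos_of_pos (by norm_num) _
  refine ⟨fun _ _ _ => 2 * kk, CY * (256 : ℝ) ^ lam + (256 : ℝ) ^ lam, δT,
    add_nonneg (mul_nonneg hCY0 h256.le) h256.le, hδT, ?_⟩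
  intro δ hδ x ρ R hδρ hρR hR1 hball
  have hδ0 : 0 < δ := hδ.1
  have hρ0 : 0 < ρ := hδ0.trans_le hδρ
  have hR0 : 0 < R := hρ0.trans hρR
  set q : ℝ := ρ / R with hq
  have hq0 : 0 < q := div_pos hρ0 hR0
  have hqlam : 0 ≤ q ^ lam := Real.rpow_nonneg hq0.le lam
  have hP1 : law D.carrier δ (a δ) (b δ) {γ : DomainSAW D.carrier δ (a δ) (b δ) |
      (⟨γ.walk.toCurve (meshPoint δ)⟩ : Curve ℂ).HasTraversals (2 * kk) x ρ R} ≤ 1 := by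
    refine (measure_mono (Set.subset_univ _)).trans ?_
    rw [law, Measure.smul_apply, smul_eq_mul]
    exact ENNReal.inv_mul_le_one _
  -- number of scales
  have hex : ∃ n : ℕ, R < 4 ^ (n + 4) * ρ := by
    obtain ⟨n, hn⟩ := pow_unbounded_of_one_lt (R / ρ) (by norm_num : (1 : ℝ) < 4)
    refine ⟨n, ?_⟩
    rw [div_lt_iff₀ hρ0] at hn
    calc R < 4 ^ n * ρ := hn
      _ ≤ 4 ^ (n + 4) * ρ := by
          refine mul_le_mul_of_nonneg_right ?_ hρ0.le
          exact pow_le_pow_right₀ (by norm_num) (by omega)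
  set L := Nat.find hex with hL
  have hLspec : R < 4 ^ (L + 4) * ρ := Nat.find_spec hex
  -- trivial regime
  by_cases hL0 : L = 0
  · rw [hL0] at hLspec
    norm_num at hLspec
    exact hP1.trans (ENNReal.one_le_ofReal.2 (one_le_trivial_regime hlam hρ0 hR0 hCY0 hLspec))
  -- main regime: `4^{L+3} ρ ≤ R`
  have hL1 : 1 ≤ L := Nat.one_le_iff_ne_zero.2 hL0
  have hmain : 4 ^ (L + 3) * ρ ≤ R := by
    have := Nat.find_min hex (m := L - 1) (by omega)
    rw [not_lt, show L - 1 + 4 = L + 3 by omega] at this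
    exact this
  -- boxes
  set c : Site 2 := nearestSite δ x with hc
  set NL : ℕ := ⌈ρ / δ⌉₊ + 4 with hNL
  set Nf : ℕ → ℕ := fun l => 4 ^ (L - l) * NL with hNf
  have hNL1 : ρ / δ + 3 < NL := by
    have := Nat.le_ceil (ρ / δ); simp only [hNL]; push_cast; linarith
  have hNLle : (NL : ℝ) ≤ 6 * (ρ / δ) := by
    have h1 : (⌈ρ / δ⌉₊ : ℝ) < ρ / δ + 1 := Nat.ceil_lt_add_one (by positivity)
    have h2 : 1 ≤ ρ / δ := by rw [le_div_iff₀ hδ0, one_mul]; exact hδρ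
    simp only [hNL]; push_cast; linarith
  have hNfl : ∀ l, NL ≤ Nf l := fun l => Nat.le_mul_of_pos_left _ (pow_pos (by norm_num) _)
  have hNL0 : 4 ≤ NL := by rw [hNL]; omega
  have hNf1 : ∀ l, 1 ≤ Nf l := fun l => le_trans (by norm_num) (hNL0.trans (hNfl l))
  have hNf4 : 4 ≤ Nf 0 := hNL0.trans (hNfl 0)
  have hNf0 : ∀ l, Nf l ≤ Nf 0 := fun l => by
    simp only [hNf, Nat.sub_zero]
    exact Nat.mul_le_mul_right _ (Nat.pow_le_pow_right (by norm_num) (Nat.sub_le _ _))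
  have hN4 : ∀ l, l < L → 4 * Nf (l + 1) = Nf l := fun l hl => by
    simp only [hNf]
    rw [show L - l = L - (l + 1) + 1 by omega, pow_succ]
    ring
  -- the master inequality `(4 N₀ + 1) δ ≤ R`
  have hmaster : (4 * Nf 0 + 1 : ℝ) * δ ≤ R := by
    have h1 : (Nf 0 : ℝ) = 4 ^ L * NL := by simp [hNf]
    rw [h1]
    exact scales_master_ineq hδ0 hρ0 hδρ hNLle hmain
  have hfarR : ∀ l, 3 * (Nf l : ℝ) * δ + 3 * δ ≤ R := fun l => by
    have h1 : (Nf l : ℝ) ≤ Nf 0 := by exact_mod_cast hNf0 l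
    have h2 : (4 : ℝ) ≤ Nf 0 := by exact_mod_cast hNf4
    have h3 : (3 * (Nf l : ℝ) + 3) * δ ≤ (4 * Nf 0 + 1) * δ :=
      mul_le_mul_of_nonneg_right (by linarith) hδ0.le
    linarith
  have hnearN : ∀ l, ρ / δ + 3 < (Nf l : ℝ) := fun l =>
    hNL1.trans_le (by exact_mod_cast hNfl l)
  have hcx : dist (meshPoint δ c) x ≤ δ := dist_meshPoint_nearestSite_le hδ0 x
  have hballc : Metric.closedBall (meshPoint δ c) (4 * (Nf 0 : ℝ) * δ) ⊆ D.carrier := by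
    refine subset_trans (Metric.closedBall_subset_closedBall' ?_) hball
    linarith
  have hbox : ∀ l, closedBox δ c (Nf l) ⊆ D.carrier := fun l => by
    refine (closedBox_subset_closedBall δ c (Nf l)).trans (subset_trans ?_ hballc)
    refine Metric.closedBall_subset_closedBall ?_
    have h1 : (Nf l : ℝ) ≤ Nf 0 := by exact_mod_cast hNf0 l
    nlinarith
  -- the finite weighted set
  haveI : Finite (DomainSAW D.carrier δ (a δ) (b δ)) := finite_domainSAW D.isBounded hδ0 _ _
  haveI : Fintype (DomainSAW D.carrier δ (a δ) (b δ)) := Fintype.ofFinite _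
  set w : DomainSAW D.carrier δ (a δ) (b δ) → ℝ :=
    fun γ => (law D.carrier δ (a δ) (b δ) {γ}).toReal with hw
  set f : ℕ → DomainSAW D.carrier δ (a δ) (b δ) → Set (Sym2 (Site 2)) :=
    fun l γ => outEdgeSet γ c (Nf l) with hf
  set h : ℕ → DomainSAW D.carrier δ (a δ) (b δ) → ℕ :=
    fun l γ => Nat.findGreatest (HasPieces γ c (Nf l) (Nf l)) (γ.walk.length + 1) with hh
  have hiter := hchain w (fun γ => ENNReal.toReal_nonneg) f h L ?_ ?_ ?_ ?_
  rotate_left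
  · -- refinement of the outside configurations
    intro l hl γ γ' hγ
    simp only [hf] at hγ ⊢
    exact outEdgeSet_eq_of_le c (by rw [← hN4 l hl]; omega) hγ
  · -- measurability of the heaviness
    intro l hl γ γ' hγ
    simp only [hf, hh] at hγ ⊢
    exact findGreatest_eq_of_outEdgeSet_eq (hNf1 l) hγ
  · -- top state
    intro m
    have hset : {γ : DomainSAW D.carrier δ (a δ) (b δ) | m ≤ h 0 γ} =
        {γ | HasPieces γ c (Nf 0) (Nf 0) m} :=
      Set.ext fun γ => (hasPieces_iff_le_findGreatest (γ := γ)).symm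
    have h1 := hTop δ hδ c (Nf 0) m (hNf1 0) hballc
    rw [← hset] at h1
    have h2 : law D.carrier δ (a δ) (b δ) {γ | m ≤ h 0 γ} ≤
        ENNReal.ofReal (CT' * Real.exp (-(c₁ * m))) :=
      h1.trans (ENNReal.ofReal_le_ofReal
        (mul_le_mul_of_nonneg_right (le_max_left _ _) (Real.exp_pos _).le))
    have h3 := ENNReal.toReal_le_of_le_ofReal (by positivity) h2
    rw [toReal_law_setOf] at h3
    exact h3
  · -- one-scale contraction
    intro l hl γ₀ j hj
    have hm : h l γ₀ = Nat.findGreatest (HasPieces γ₀ c (Nf l) (Nf l)) (γ₀.walk.length + 1) :=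
      rfl
    have hnot : ¬ HasPieces γ₀ c (4 * Nf (l + 1)) (4 * Nf (l + 1)) (h l γ₀ + 1) := by
      rw [hN4 l hl, hasPieces_iff_le_findGreatest, hm]
      omega
    have hj' : θ * (h l γ₀) + m₀ ≤ (j : ℝ) := by
      have : θ * (h l γ₀) ≤ θ' * (h l γ₀) :=
        mul_le_mul_of_nonneg_right (le_max_left _ _) (Nat.cast_nonneg _)
      linarith
    have h1 := hHC D.carrier δ (a δ) (b δ) c (Nf (l + 1)) (h l γ₀) j γ₀ D.isBounded hδ0
      (hNf1 _) (by rw [hN4 l hl]; exact hbox l) hnot hj'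
    rw [hN4 l hl] at h1
    have hsetA : {γ : DomainSAW D.carrier δ (a δ) (b δ) |
        outEdgeSet γ c (Nf l) = outEdgeSet γ₀ c (Nf l) ∧
          HasPieces γ c (Nf (l + 1)) (Nf (l + 1)) j} =
        {γ | f l γ = f l γ₀ ∧ j ≤ h (l + 1) γ} := by
      ext γ
      simp only [Set.mem_setOf_eq, hf, hh, hasPieces_iff_le_findGreatest]
    have hsetB : {γ : DomainSAW D.carrier δ (a δ) (b δ) |
        outEdgeSet γ c (Nf l) = outEdgeSet γ₀ c (Nf l)} = {γ | f l γ = f l γ₀} := by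
      ext γ
      simp only [Set.mem_setOf_eq, hf]
    rw [hsetA, hsetB] at h1
    have h2 : law D.carrier δ (a δ) (b δ) {γ | f l γ = f l γ₀ ∧ j ≤ h (l + 1) γ} ≤
        ENNReal.ofReal (C' * (2 : ℝ) ^ (-(lam0 * j))) *
          law D.carrier δ (a δ) (b δ) {γ | f l γ = f l γ₀} :=
      h1.trans (mul_le_mul' (ENNReal.ofReal_le_ofReal
        (mul_le_mul_of_nonneg_right (le_max_left _ _) (Real.rpow_nonneg (by norm_num) _))) le_rfl)
    have h3 := ENNReal.toReal_mono (ENNReal.mul_ne_top ENNReal.ofReal_ne_top (law_ne_top _)) h2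
    rw [ENNReal.toReal_mul, ENNReal.toReal_ofReal (by positivity), toReal_law_setOf,
      toReal_law_setOf] at h3
    exact h3
  -- traversals force heaviness at every scale
  have hsub : {γ : DomainSAW D.carrier δ (a δ) (b δ) |
      (⟨γ.walk.toCurve (meshPoint δ)⟩ : Curve ℂ).HasTraversals (2 * kk) x ρ R} ⊆
      {γ | ∀ l ≤ L, kk ≤ h l γ} := by
    intro γ hγ l _
    exact hasPieces_iff_le_findGreatest.1
      (stub_chain_transfer hδ0 γ (hnearN l) (hfarR l) hγ)
  -- the bound `C_Y ε^L ≤ C_Y 256^λ (ρ/R)^λ`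
  have hεL : ε ^ L ≤ (256 : ℝ) ^ lam * q ^ lam := eps_pow_le_shell hlam hρ0 hR0 hLspec
  have hfin : (law D.carrier δ (a δ) (b δ) {γ | ∀ l ≤ L, kk ≤ h l γ}).toReal ≤
      CY * ((256 : ℝ) ^ lam * q ^ lam) := by
    rw [toReal_law_setOf]
    exact hiter.trans (mul_le_mul_of_nonneg_left hεL hCY0)
  calc _ ≤ law D.carrier δ (a δ) (b δ) {γ | ∀ l ≤ L, kk ≤ h l γ} := measure_mono hsub
    _ ≤ ENNReal.ofReal (CY * (256 ^ lam * q ^ lam)) :=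
        (ENNReal.le_ofReal_iff_toReal_le (law_ne_top _) (by positivity)).2 hfin
    _ ≤ ENNReal.ofReal ((CY * 256 ^ lam + 256 ^ lam) * q ^ lam) := by
        refine ENNReal.ofReal_le_ofReal ?_
        nlinarith [mul_nonneg hCY0 h256.le]

end Summit.CriticalPhenomena.SAWScalingLimit.Theorems.TPToTraversalBound.Radial

end
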